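import Mathlib
import Literature.AlgebraicGeometry.HyperbolicPolynomials.HyperbolicityCone
import HarnessLib

/-!
# Monic symmetric linear pencils have real zero determinants (BPT 2012, Ch. 6, §6.2.3)

Source: J. Nie, *Semidefinite Representability*, Chapter 6 of G. Blekherman, P. A. Parrilo,
R. R. Thomas (eds.), *Semidefinite Optimization and Convex Algebraic Geometry*, MOS–SIAM Ser.
Optim. 13, SIAM 2012 [cite: BlekhermanParriloThomas2012, Ch. 6 §6.2.3 (real zero polynomials,
Examples 6.1–6.2, Theorem 6.5 (first statement)) and §6.3.1 (TV screen, hyperboloid)]; the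
notion of a *real zero (RZ) polynomial* is from J. W. Helton, V. Vinnikov, *Linear matrix
inequality representation of sets*, Comm. Pure Appl. Math. 60 (2007) [cite: HeltonVinnikov2006,
§2.1].

A polynomial `p ∈ ℝ[x₁,…,xₘ]` is *real zero* (RZ) if for every direction `w ∈ ℝᵐ` the
univariate restriction `t ↦ p(t w)` has only real zeros; it is RZ *with respect to a point* `u`
if the same holds for `t ↦ p(u + t w)` (§6.2.3, around Example 6.2).  The necessity half of the
Helton–Vinnikov theory (BPT Thm. 6.5, first sentence: "if a set `S` is defined by a monic LMI
then `S` is rigidly convex") rests on the matrix fact proved here: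

* `isRZPoly_monicPencilDet` — for real symmetric `A₁,…,Aₘ` the determinant
  `p(x) = det (I + x₁A₁ + ⋯ + xₘAₘ)` of the *monic* symmetric pencil is an RZ polynomial:
  along the line `x = t w` one has `p(t w) = det (I + t W) = ∏ᵢ (1 + t λᵢ(W))` with
  `W = ∑ wᵢAᵢ` symmetric (`lineDet_eq_prod`, spectral theorem), a product of real linear factors;
* `im_eq_zero_of_det_one_add_smul_eq_zero` — the same fact read over `ℂ`: if
  `det (I + z W) = 0` for a real symmetric `W` and `z ∈ ℂ` then `z ∈ ℝ`;
* Example 6.1 / 6.2(i): the elliptope cubic `2x₁x₂x₃ − x₁² − x₂² − x₃² + 1` is the determinant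
  of the `3 × 3` monic symmetric pencil `elliptopePencil`, hence RZ (`isRZPoly_elliptopeCubic`);
* Example 6.2(ii) / §6.3.1: the TV-screen quartic `1 − x₁⁴ − x₂⁴` is **not** RZ (its
  restriction to the `x₁`-axis, `1 − t⁴`, has the root `i`), hence it is not the determinant of
  any monic symmetric linear pencil of any size (`tvScreen_ne_monicPencilDet`,
  `not_exists_monic_symmetric_detRep_tvScreen`);
* §6.3.1: the hyperboloid cubic `x₁x₂x₃ − 1` is not RZ with respect to the interior point
  `u = (1,1,2)` of `{x ∈ ℝ³₊ : x₁x₂x₃ ≥ 1}` (`not_isRZPolyAt_hyperboloidCubic`): along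
  `w = (1,1,1)` the restriction is `t³ + 4t² + 5t + 1`, whose cubic discriminant is `−23 < 0`.

Conventions.  The restriction `t ↦ p(u + t w)` is the tree's
`Literature.AlgebraicGeometry.HyperbolicPolynomials.linePoly p u w` (reused, not restated).  We
do not include the normalisation `p(0) > 0` (resp. `p(u) > 0`) of the printed definition in
`IsRZPoly` / `IsRZPolyAt`; for the pencil determinant it holds separately
(`eval_zero_monicPencilDet`).  "Only real zeros" of a real univariate polynomial is rendered as
`Polynomial.Splits` over `ℝ`, equivalently `roots.card = natDegree` (`isRZPoly_iff_card_roots`),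
equivalently — when `p(u) ≠ 0` — "every complex root of the complexified restriction is real"
(`isRZPolyAt_iff_im_eq_zero`, the rendering of
`Literature.AlgebraicGeometry.HyperbolicPolynomials.IsHyperbolic`; RZ at `u` asks this for
every *direction* through the fixed point `u`, hyperbolicity for every *base point* in a fixed
direction).  The homogeneous three-variable version of `isRZPoly_monicPencilDet` is the tree's
`Literature.AlgebraicGeometry.DeterminantalHypersurfaces.det_pencil_hyperbolic` (not used
here).  The converse direction in two variables (every RZ polynomial of degree `d` with
`p(0) > 0` is the determinant of a `d × d` monic symmetric pencil) is the Helton–Vinnikov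
theorem, BPT Thm. 6.8, stated in the tree as
`Literature.AlgebraicGeometry.DeterminantalHypersurfaces.LewisParriloRamana2005_laxConjecture`
and not restated here.
-/

noncomputable section

open Polynomial Matrix Finset
open Literature.AlgebraicGeometry.HyperbolicPolynomials (linePoly eval_linePoly map_linePoly)

namespace Literature.AlgebraicGeometry.DeterminantalHypersurfaces.MonicPencilRealZero

/-! ## The univariate restriction `det (I + t W)` -/

section CommRing

/-- The polynomial `t ↦ det (I + t W) ∈ R[t]` of a square matrix `W` (the restriction of the
determinant of a monic linear pencil to a line through the origin).
[cite: BlekhermanParriloThomas2012, Ch. 6 §6.2.3] -/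
def lineDet {R : Type*} [CommRing R] {n : Type*} [Fintype n] [DecidableEq n]
    (W : Matrix n n R) : R[X] :=
  det (1 + (X : R[X]) • W.map C)

/-- `lineDet W` is Mathlib's reverse characteristic polynomial of `-W`:
`det (I + tW) = det (I − t(−W))`. [cite: BlekhermanParriloThomas2012, Ch. 6 §6.2.3] -/
theorem lineDet_eq_charpolyRev {R : Type*} [CommRing R] {n : Type*} [Fintype n] [DecidableEq n]
    (W : Matrix n n R) : lineDet W = (-W).charpolyRev := by
  rw [lineDet, Matrix.charpolyRev]
  congr 1
  ext i j
  simp [sub_eq_add_neg]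

/-- Evaluation: `(lineDet W)(t) = det (I + t W)`.
[cite: BlekhermanParriloThomas2012, Ch. 6 §6.2.3] -/
theorem eval_lineDet {R : Type*} [CommRing R] {n : Type*} [Fintype n] [DecidableEq n]
    (W : Matrix n n R) (t : R) :
    (lineDet W).eval t = det (1 + t • W) := by
  rw [lineDet, ← coe_evalRingHom, RingHom.map_det, RingHom.mapMatrix_apply]
  congr 1
  refine Matrix.ext fun i j => ?_
  by_cases h : i = j
  · subst h; simp [mul_comm t]
  · simp [h, mul_comm t]

/-- `(lineDet W)(0) = 1`. [cite: BlekhermanParriloThomas2012, Ch. 6 §6.2.3] -/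
theorem eval_zero_lineDet {R : Type*} [CommRing R] {n : Type*} [Fintype n] [DecidableEq n]
    (W : Matrix n n R) : (lineDet W).eval 0 = 1 := by
  simp [eval_lineDet]

/-- `lineDet W ≠ 0` (over a nontrivial ring). [cite: BlekhermanParriloThomas2012, Ch. 6 §6.2.3] -/
theorem lineDet_ne_zero {R : Type*} [CommRing R] {n : Type*} [Fintype n] [DecidableEq n]
    [Nontrivial R] (W : Matrix n n R) : lineDet W ≠ 0 := by
  intro h
  have h1 := eval_zero_lineDet W
  rw [h, eval_zero] at h1
  exact zero_ne_one h1

/-- Base change: `(lineDet W).map f = lineDet (W.map f)` for a ring homomorphism `f`.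
[cite: BlekhermanParriloThomas2012, Ch. 6 §6.2.3] -/
theorem map_lineDet {R : Type*} [CommRing R] {n : Type*} [Fintype n] [DecidableEq n]
    {S : Type*} [CommRing S] (f : R →+* S) (W : Matrix n n R) :
    (lineDet W).map f = lineDet (W.map f) := by
  rw [lineDet, lineDet, ← coe_mapRingHom, RingHom.map_det, RingHom.mapMatrix_apply]
  congr 1
  ext i j
  by_cases h : i = j
  · subst h; simp
  · simp [h]

end CommRing

/-! ## Real symmetric `W`: `det (I + tW) = ∏ᵢ (1 + t λᵢ)` -/

section Real

/-- Spectral factorisation: for a real symmetric (= Hermitian) matrix `W` with eigenvalues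
`λᵢ`, `det (I + t W) = ∏ᵢ (λᵢ t + 1)` in `ℝ[t]`.
[cite: BlekhermanParriloThomas2012, Ch. 6 §6.2.3 (proof sketch before Thm. 6.5)] -/
theorem lineDet_eq_prod {n : Type*} [Fintype n] [DecidableEq n]
    (W : Matrix n n ℝ) (hW : W.IsHermitian) :
    lineDet W = ∏ i, (C (hW.eigenvalues i) * X + 1) := by
  set U : Matrix n n ℝ := (hW.eigenvectorUnitary : Matrix n n ℝ) with hU
  have hspec : W = U * diagonal hW.eigenvalues * star U := by
    have h := hW.spectral_theorem
    rw [Unitary.conjStarAlgAut_apply] at h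
    simpa [RCLike.ofReal_real_eq_id] using h
  have hunit : U * star U = 1 := Matrix.mem_unitaryGroup_iff.mp (hW.eigenvectorUnitary).2
  set Uc : Matrix n n ℝ[X] := U.map C with hUc
  set Vc : Matrix n n ℝ[X] := (star U).map C with hVc
  have hUV : Uc * Vc = 1 := by
    rw [hUc, hVc, ← Matrix.map_mul, hunit, Matrix.map_one C C_0 C_1]
  have hWc : W.map C = Uc * diagonal (fun i => C (hW.eigenvalues i)) * Vc := by
    conv_lhs => rw [hspec]
    rw [Matrix.map_mul, Matrix.map_mul, diagonal_map (map_zero C)]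
  have hdiag : diagonal (fun i => C (hW.eigenvalues i) * X + 1)
      = 1 + (X : ℝ[X]) • diagonal (fun i => C (hW.eigenvalues i)) := by
    ext i j
    by_cases h : i = j
    · subst h
      simp only [diagonal_apply_eq, Matrix.add_apply, Matrix.one_apply_eq, Matrix.smul_apply,
        smul_eq_mul]
      ring
    · simp [h]
  have key : (1 : Matrix n n ℝ[X]) + (X : ℝ[X]) • W.map C =
      Uc * diagonal (fun i => C (hW.eigenvalues i) * X + 1) * Vc := by
    rw [hWc, hdiag, Matrix.mul_add, Matrix.add_mul, Matrix.mul_one, hUV, Matrix.mul_smul,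
      Matrix.smul_mul]
  have hdet : Uc.det * Vc.det = 1 := by rw [← det_mul, hUV, det_one]
  rw [lineDet, key, det_mul, det_mul, det_diagonal]
  calc Uc.det * (∏ i, (C (hW.eigenvalues i) * X + 1)) * Vc.det
      = (∏ i, (C (hW.eigenvalues i) * X + 1)) * (Uc.det * Vc.det) := by ring
    _ = ∏ i, (C (hW.eigenvalues i) * X + 1) := by rw [hdet, mul_one]

/-- For real symmetric `W`, `det (I + tW)` has only real roots: it splits over `ℝ` into linear
factors. [cite: BlekhermanParriloThomas2012, Ch. 6 §6.2.3] -/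
theorem splits_lineDet {n : Type*} [Fintype n] [DecidableEq n]
    (W : Matrix n n ℝ) (hW : W.IsHermitian) : (lineDet W).Splits := by
  rw [lineDet_eq_prod W hW]
  refine Splits.prod fun i _ => Splits.of_degree_le_one ?_
  rw [← C_1]
  exact degree_linear_le

/-- `splits_lineDet` with the hypothesis spelled `W.IsSymm`.
[cite: BlekhermanParriloThomas2012, Ch. 6 §6.2.3] -/
theorem splits_lineDet_of_isSymm {n : Type*} [Fintype n] [DecidableEq n]
    (W : Matrix n n ℝ) (hW : W.IsSymm) : (lineDet W).Splits :=
  splits_lineDet W (isHermitian_iff_isSymm.mpr hW)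

/-- Root count: for real symmetric `W`, `det (I + tW)` has `natDegree`-many real roots counted
with multiplicity. [cite: BlekhermanParriloThomas2012, Ch. 6 §6.2.3] -/
theorem card_roots_lineDet {n : Type*} [Fintype n] [DecidableEq n]
    (W : Matrix n n ℝ) (hW : W.IsHermitian) :
    Multiset.card (lineDet W).roots = (lineDet W).natDegree :=
  splits_iff_card_roots.mp (splits_lineDet W hW)

/-- The real roots of `det (I + tW)` are exactly the `t` with `λᵢ t + 1 = 0` for some
eigenvalue `λᵢ` of `W`, i.e. `t = −1/λᵢ` for the non-zero eigenvalues.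
[cite: BlekhermanParriloThomas2012, Ch. 6 §6.2.3] -/
theorem isRoot_lineDet_iff {n : Type*} [Fintype n] [DecidableEq n]
    (W : Matrix n n ℝ) (hW : W.IsHermitian) (t : ℝ) :
    (lineDet W).IsRoot t ↔ ∃ i, hW.eigenvalues i * t + 1 = 0 := by
  rw [IsRoot, lineDet_eq_prod W hW, eval_prod, Finset.prod_eq_zero_iff]
  simp

/-- Every complex root of `det (I + tW)`, `W` real symmetric, is real.
[cite: BlekhermanParriloThomas2012, Ch. 6 §6.2.3] -/
theorem im_eq_zero_of_isRoot_lineDet {n : Type*} [Fintype n] [DecidableEq n]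
    (W : Matrix n n ℝ) (hW : W.IsHermitian) {z : ℂ}
    (hz : ((lineDet W).map (algebraMap ℝ ℂ)).IsRoot z) : z.im = 0 := by
  obtain ⟨r, hr⟩ := (splits_lineDet W hW).mem_range_of_isRoot (lineDet_ne_zero W) hz
  rw [← hr]
  simp

/-- Matrix form over `ℂ`: if `W` is real symmetric and `det (I + z W) = 0` for a complex
number `z`, then `z` is real. [cite: BlekhermanParriloThomas2012, Ch. 6 §6.2.3] -/
theorem im_eq_zero_of_det_one_add_smul_eq_zero {n : Type*} [Fintype n] [DecidableEq n]
    (W : Matrix n n ℝ) (hW : W.IsHermitian)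
    {z : ℂ} (hz : det (1 + z • W.map (algebraMap ℝ ℂ)) = 0) : z.im = 0 := by
  refine im_eq_zero_of_isRoot_lineDet W hW ?_
  rw [IsRoot, map_lineDet, eval_lineDet, hz]

end Real

/-! ## Real zero polynomials -/

section RealZero

/-- A real polynomial `p` is a **real zero (RZ) polynomial** if for every direction `w` the
restriction `t ↦ p(t w)` (`linePoly p 0 w`) has only real zeros, i.e. splits over `ℝ`.  The
printed definition also asks `p(0) > 0`; we keep that normalisation separate.
[cite: BlekhermanParriloThomas2012, Ch. 6 §6.2.3; HeltonVinnikov2006, §2.1] -/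
def IsRZPoly {ι : Type*} (p : MvPolynomial ι ℝ) : Prop :=
  ∀ w : ι → ℝ, (linePoly p 0 w).Splits

/-- `p` is **RZ with respect to the point `u`** if every restriction `t ↦ p(u + t w)`
(`linePoly p u w`) has only real zeros.
[cite: BlekhermanParriloThomas2012, Ch. 6 §6.2.3 (before Example 6.2)] -/
def IsRZPolyAt {ι : Type*} (u : ι → ℝ) (p : MvPolynomial ι ℝ) : Prop :=
  ∀ w : ι → ℝ, (linePoly p u w).Splits

/-- RZ with respect to the origin is RZ (by definition).
[cite: BlekhermanParriloThomas2012, Ch. 6 §6.2.3] -/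
theorem isRZPolyAt_zero_iff {ι : Type*}
    (p : MvPolynomial ι ℝ) : IsRZPolyAt 0 p ↔ IsRZPoly p := Iff.rfl

/-- The root-count rendering of the RZ property: every restriction `t ↦ p(t w)` has as many
real roots (with multiplicity) as its degree. [cite: BlekhermanParriloThomas2012, Ch. 6 §6.2.3] -/
theorem isRZPoly_iff_card_roots {ι : Type*} (p : MvPolynomial ι ℝ) :
    IsRZPoly p ↔ ∀ w : ι → ℝ,
      Multiset.card (linePoly p 0 w).roots = (linePoly p 0 w).natDegree := by
  simp [IsRZPoly, splits_iff_card_roots]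

/-- The complex-root rendering of the RZ property at a point `u` with `p(u) ≠ 0`: `p` is RZ with
respect to `u` iff every complex zero `z` of every complexified restriction `t ↦ p(u + t w)`,
`w` real, is real.  (Compare `Literature.AlgebraicGeometry.HyperbolicPolynomials.IsHyperbolic`,
which fixes the direction and varies the base point.)
[cite: BlekhermanParriloThomas2012, Ch. 6 §6.2.3; HeltonVinnikov2006, §2.1] -/
theorem isRZPolyAt_iff_im_eq_zero {ι : Type*} {u : ι → ℝ} {p : MvPolynomial ι ℝ}
    (hu : MvPolynomial.eval u p ≠ 0) :
    IsRZPolyAt u p ↔ ∀ (w : ι → ℝ) (z : ℂ),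
      ((linePoly p u w).map (algebraMap ℝ ℂ)).IsRoot z → z.im = 0 := by
  have h0 : ∀ w, linePoly p u w ≠ 0 := fun w h =>
    hu (by simpa [h] using (eval_linePoly p u w 0).symm)
  refine ⟨fun h w z hz => ?_, fun h w => ?_⟩
  · obtain ⟨r, hr⟩ := (h w).mem_range_of_isRoot (h0 w) hz
    rw [← hr]
    simp
  · refine Splits.of_splits_map (algebraMap ℝ ℂ) (IsAlgClosed.splits _) fun a ha => ?_
    have him : a.im = 0 := h w a (isRoot_of_mem_roots ha)
    exact ⟨a.re, Complex.ext (by simp) (by simp [him])⟩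

end RealZero

/-! ## Monic symmetric pencils and the real zero property -/

section Pencil

/-- The determinant `det (I + ∑ᵢ xᵢAᵢ) ∈ ℝ[xᵢ : i ∈ ι]` of the monic linear pencil with
coefficient matrices `Aᵢ`. [cite: BlekhermanParriloThomas2012, Ch. 6 §6.2.3 (Example 6.1)] -/
def monicPencilDet {ι : Type*} [Fintype ι] {n : Type*} [Fintype n] [DecidableEq n]
    (A : ι → Matrix n n ℝ) : MvPolynomial ι ℝ :=
  det (1 + ∑ i, (MvPolynomial.X i : MvPolynomial ι ℝ) • (A i).map MvPolynomial.C)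

/-- Evaluation: `(monicPencilDet A)(x) = det (I + ∑ xᵢ Aᵢ)`.
[cite: BlekhermanParriloThomas2012, Ch. 6 §6.2.3] -/
theorem eval_monicPencilDet {ι : Type*} [Fintype ι] {n : Type*} [Fintype n] [DecidableEq n]
    (A : ι → Matrix n n ℝ) (x : ι → ℝ) :
    MvPolynomial.eval x (monicPencilDet A) = det (1 + ∑ i, x i • A i) := by
  rw [monicPencilDet, RingHom.map_det, RingHom.mapMatrix_apply]
  congr 1
  ext j k
  by_cases h : j = k
  · subst h; simp [Matrix.sum_apply]
  · simp [h, Matrix.sum_apply]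

/-- `(monicPencilDet A)(0) = 1`. [cite: BlekhermanParriloThomas2012, Ch. 6 §6.2.3] -/
theorem eval_zero_monicPencilDet {ι : Type*} [Fintype ι] {n : Type*} [Fintype n] [DecidableEq n]
    (A : ι → Matrix n n ℝ) :
    MvPolynomial.eval 0 (monicPencilDet A) = 1 := by
  rw [eval_monicPencilDet]
  simp

/-- Restriction to the line `x = t w` through the origin: the line polynomial of
`monicPencilDet A` at base point `0` in direction `w` is `det (I + t W)` with `W = ∑ wᵢ Aᵢ`.
[cite: BlekhermanParriloThomas2012, Ch. 6 §6.2.3] -/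
theorem linePoly_monicPencilDet_zero {ι : Type*} [Fintype ι] {n : Type*} [Fintype n] [DecidableEq n]
    (A : ι → Matrix n n ℝ) (w : ι → ℝ) :
    linePoly (monicPencilDet A) 0 w = lineDet (∑ i, w i • A i) := by
  rw [linePoly, monicPencilDet, lineDet, AlgHom.map_det, AlgHom.mapMatrix_apply]
  congr 1
  refine Matrix.ext fun j k => ?_
  have hsum : ∑ i, C (w i) * X * C (A i j k) = X * C ((∑ i, w i • A i) j k) := by
    rw [Matrix.sum_apply, map_sum, Finset.mul_sum]
    exact Finset.sum_congr rfl fun i _ => by rw [Matrix.smul_apply, smul_eq_mul, map_mul]; ring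
  by_cases h : j = k
  · subst h
    simpa [Matrix.sum_apply, Polynomial.algebraMap_eq] using hsum
  · simpa [h, Matrix.sum_apply, Polynomial.algebraMap_eq] using hsum

/-- **BPT 2012, Thm. 6.5 (first statement; Helton–Vinnikov).** The determinant of a monic
linear pencil with real symmetric coefficient matrices is a real zero polynomial: a set defined
by a monic LMI is rigidly convex. [cite: BlekhermanParriloThomas2012, Ch. 6 Thm. 6.5 (first
statement) and §6.2.3; HeltonVinnikov2006, §2.1] -/
theorem isRZPoly_monicPencilDet {ι : Type*} [Fintype ι] {n : Type*} [Fintype n] [DecidableEq n]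
    (A : ι → Matrix n n ℝ) (hA : ∀ i, (A i).IsSymm) :
    IsRZPoly (monicPencilDet A) := by
  intro w
  rw [linePoly_monicPencilDet_zero]
  refine splits_lineDet_of_isSymm _ ?_
  unfold Matrix.IsSymm
  rw [transpose_sum]
  exact Finset.sum_congr rfl fun i _ => by rw [transpose_smul, (hA i).eq]

/-- Pointwise form of Thm. 6.5 (first statement): for real symmetric `Aᵢ` and any direction
`w`, `t ↦ det (I + t ∑ wᵢAᵢ)` has `natDegree`-many real roots.
[cite: BlekhermanParriloThomas2012, Ch. 6 Thm. 6.5 (first statement)] -/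
theorem card_roots_linePoly_monicPencilDet
    {ι : Type*} [Fintype ι] {n : Type*} [Fintype n] [DecidableEq n]
    (A : ι → Matrix n n ℝ) (hA : ∀ i, (A i).IsSymm)
    (w : ι → ℝ) :
    Multiset.card (linePoly (monicPencilDet A) 0 w).roots =
      (linePoly (monicPencilDet A) 0 w).natDegree :=
  (isRZPoly_iff_card_roots _).mp (isRZPoly_monicPencilDet A hA) w

/-- Complex form of Thm. 6.5 (first statement): for real symmetric `Aᵢ`, real `w` and complex
`z`, `det (I + z ∑ wᵢAᵢ) = 0` forces `z ∈ ℝ` — the pencil determinant has no non-real zeros on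
complexified real lines through the origin.
[cite: BlekhermanParriloThomas2012, Ch. 6 Thm. 6.5 (first statement)] -/
theorem im_eq_zero_of_det_monicPencil_eq_zero
    {ι : Type*} [Fintype ι] {n : Type*} [Fintype n] [DecidableEq n]
    (A : ι → Matrix n n ℝ) (hA : ∀ i, (A i).IsSymm)
    (w : ι → ℝ) {z : ℂ} (hz : det (1 + z • (∑ i, w i • A i).map (algebraMap ℝ ℂ)) = 0) :
    z.im = 0 := by
  refine im_eq_zero_of_det_one_add_smul_eq_zero _ (isHermitian_iff_isSymm.mpr ?_) hz
  unfold Matrix.IsSymm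
  rw [transpose_sum]
  exact Finset.sum_congr rfl fun i _ => by rw [transpose_smul, (hA i).eq]

/-- Restriction to a general line `x = u + t w`: the line polynomial of `monicPencilDet A` at
base point `u` in direction `w` is `det ((I + ∑ uᵢAᵢ) + t ∑ wᵢAᵢ)` as a polynomial in `t`.
[cite: BlekhermanParriloThomas2012, Ch. 6 §6.2.3] -/
theorem linePoly_monicPencilDet {ι : Type*} [Fintype ι] {n : Type*} [Fintype n] [DecidableEq n]
    (A : ι → Matrix n n ℝ) (u w : ι → ℝ) :
    linePoly (monicPencilDet A) u w =
      det ((1 + ∑ i, u i • A i).map C + (X : ℝ[X]) • (∑ i, w i • A i).map C) := by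
  rw [linePoly, monicPencilDet, AlgHom.map_det, AlgHom.mapMatrix_apply]
  congr 1
  refine Matrix.ext fun j k => ?_
  have hsum : ∑ i, (C (w i) * X + C (u i)) * C (A i j k) =
      C ((∑ i, u i • A i) j k) + X * C ((∑ i, w i • A i) j k) := by
    rw [Matrix.sum_apply, Matrix.sum_apply, map_sum, map_sum, Finset.mul_sum,
      ← Finset.sum_add_distrib]
    exact Finset.sum_congr rfl fun i _ => by
      rw [Matrix.smul_apply, Matrix.smul_apply, smul_eq_mul, smul_eq_mul, map_mul, map_mul]
      ring
  by_cases h : j = k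
  · subst h
    simpa [Matrix.sum_apply, Polynomial.algebraMap_eq, add_assoc] using hsum
  · simpa [h, Matrix.sum_apply, Polynomial.algebraMap_eq] using hsum

/-- **BPT 2012, Thm. 6.5 (first statement), at an arbitrary interior point.** For real
symmetric `Aᵢ` the pencil determinant `p(x) = det (I + ∑ xᵢAᵢ)` is RZ with respect to every
point `u` at which the pencil is positive definite, `I + ∑ uᵢAᵢ ≻ 0`: writing
`P = I + ∑ uᵢAᵢ = S²` with `S ≻ 0` and `T = S⁻¹` (built from the spectral decomposition of `P`),
`det(T)² · p(u + t w) = det (T (P + tW) T) = det (I + t·TWT)` with `TWT` symmetric, which has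
only real zeros.  Hence a set defined by a monic LMI is rigidly convex with respect to each such
interior point. [cite: BlekhermanParriloThomas2012, Ch. 6 Thm. 6.5 (first statement) and §6.2.3
(definition of rigid convexity)] -/
theorem isRZPolyAt_monicPencilDet {ι : Type*} [Fintype ι] {n : Type*} [Fintype n] [DecidableEq n]
    (A : ι → Matrix n n ℝ) (hA : ∀ i, (A i).IsSymm) {u : ι → ℝ}
    (hu : (1 + ∑ i, u i • A i).PosDef) : IsRZPolyAt u (monicPencilDet A) := by
  intro w
  set P : Matrix n n ℝ := 1 + ∑ i, u i • A i with hP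
  set W : Matrix n n ℝ := ∑ i, w i • A i with hW
  have hWs : W.IsSymm := by
    unfold Matrix.IsSymm
    rw [hW, transpose_sum]
    exact Finset.sum_congr rfl fun i _ => by rw [transpose_smul, (hA i).eq]
  have hPh : P.IsHermitian := hu.1
  -- spectral decomposition of `P` and the symmetric inverse square root `T`
  set U : Matrix n n ℝ := (hPh.eigenvectorUnitary : Matrix n n ℝ) with hUdef
  have hspec : P = U * diagonal hPh.eigenvalues * star U := by
    have h := hPh.spectral_theorem
    rw [Unitary.conjStarAlgAut_apply] at h
    simpa [RCLike.ofReal_real_eq_id] using h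
  have hU1 : U * star U = 1 := Matrix.mem_unitaryGroup_iff.mp (hPh.eigenvectorUnitary).2
  have hU2 : star U * U = 1 := Matrix.mem_unitaryGroup_iff'.mp (hPh.eigenvectorUnitary).2
  have hpos : ∀ i, 0 < hPh.eigenvalues i := hu.eigenvalues_pos
  set d : n → ℝ := fun i => (Real.sqrt (hPh.eigenvalues i))⁻¹ with hd
  have hdpos : ∀ i, 0 < d i := fun i => inv_pos.mpr (Real.sqrt_pos.mpr (hpos i))
  have hdd : ∀ i, d i * hPh.eigenvalues i * d i = 1 := by
    intro i
    have hs : Real.sqrt (hPh.eigenvalues i) ≠ 0 := (Real.sqrt_pos.mpr (hpos i)).ne'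
    simp only [hd]
    field_simp
    rw [Real.sq_sqrt (hpos i).le]
  set T : Matrix n n ℝ := U * diagonal d * star U with hT
  clear_value T
  have hstarU : star U = Uᵀ := by
    rw [star_eq_conjTranspose, conjTranspose_eq_transpose_of_trivial]
  have hTs : T.IsSymm := by
    unfold Matrix.IsSymm
    rw [hT, hstarU, transpose_mul, transpose_mul, diagonal_transpose, transpose_transpose,
      Matrix.mul_assoc]
  have hTPT : T * P * T = 1 := by
    rw [hspec, hT]
    calc U * diagonal d * star U * (U * diagonal hPh.eigenvalues * star U) *
          (U * diagonal d * star U)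
        = U * (diagonal d * (star U * U) * diagonal hPh.eigenvalues * (star U * U) *
            diagonal d) * star U := by simp only [Matrix.mul_assoc]
      _ = U * diagonal (fun i => d i * hPh.eigenvalues i * d i) * star U := by
          rw [hU2, Matrix.mul_one, Matrix.mul_one, diagonal_mul_diagonal, diagonal_mul_diagonal]
      _ = 1 := by simp [hdd, hU1]
  have hTdet : T.det ≠ 0 := by
    have h1 : U.det * (star U).det = 1 := by rw [← det_mul, hU1, det_one]
    have h2 : T.det = ∏ i, d i := by
      rw [hT, det_mul, det_mul, det_diagonal]
      calc U.det * (∏ i, d i) * (star U).det = (∏ i, d i) * (U.det * (star U).det) := by ring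
        _ = ∏ i, d i := by rw [h1, mul_one]
    rw [h2]
    exact (Finset.prod_pos fun i _ => hdpos i).ne'
  have hTWT : (T * W * T).IsSymm := by
    unfold Matrix.IsSymm
    rw [transpose_mul, transpose_mul, hTs.eq, hWs.eq, ← Matrix.mul_assoc]
  -- the polynomial identity `det(T)² · p(u + tw) = det (I + t·TWT)`
  have hmat : T.map C * (P.map C + (X : ℝ[X]) • W.map C) * T.map C =
      1 + (X : ℝ[X]) • (T * W * T).map C := by
    rw [Matrix.mul_add, Matrix.add_mul, ← Matrix.map_mul, ← Matrix.map_mul, hTPT,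
      Matrix.map_one C C_0 C_1, Matrix.mul_smul, Matrix.smul_mul, ← Matrix.map_mul,
      ← Matrix.map_mul]
  have hdetT : (T.map C).det = C T.det := by
    rw [← RingHom.mapMatrix_apply, ← RingHom.map_det]
  have hdet : C T.det ^ 2 * linePoly (monicPencilDet A) u w = lineDet (T * W * T) := by
    rw [linePoly_monicPencilDet, lineDet, ← hmat, det_mul, det_mul, hdetT, ← hP, ← hW]
    ring
  have hq : linePoly (monicPencilDet A) u w =
      C ((T.det ^ 2)⁻¹) * (C T.det ^ 2 * linePoly (monicPencilDet A) u w) := by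
    rw [← mul_assoc, ← C_pow, ← C_mul, inv_mul_cancel₀ (pow_ne_zero 2 hTdet), C_1, one_mul]
  rw [hq, hdet]
  exact (splits_lineDet_of_isSymm _ hTWT).C_mul _

end Pencil

/-! ## Example 6.1 / 6.2(i): the elliptope cubic is a monic symmetric pencil determinant -/

section Elliptope

open MvPolynomial in
/-- The elliptope cubic `2x₁x₂x₃ − x₁² − x₂² − x₃² + 1 = det [[1,x₁,x₂],[x₁,1,x₃],[x₂,x₃,1]]`
(variables indexed `0,1,2`). [cite: BlekhermanParriloThomas2012, Ch. 6 Examples 6.1, 6.2(i)] -/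
def elliptopeCubic : MvPolynomial (Fin 3) ℝ :=
  2 * X 0 * X 1 * X 2 - X 0 ^ 2 - X 1 ^ 2 - X 2 ^ 2 + 1

/-- Coefficient matrices of the monic symmetric pencil `[[1,x₁,x₂],[x₁,1,x₃],[x₂,x₃,1]]`
of Example 6.1: `A₁ = E₁₂ + E₂₁`, `A₂ = E₁₃ + E₃₁`, `A₃ = E₂₃ + E₃₂`.
[cite: BlekhermanParriloThomas2012, Ch. 6 Example 6.1] -/
def elliptopePencil : Fin 3 → Matrix (Fin 3) (Fin 3) ℝ :=
  ![!![0, 1, 0; 1, 0, 0; 0, 0, 0], !![0, 0, 1; 0, 0, 0; 1, 0, 0], !![0, 0, 0; 0, 0, 1; 0, 1, 0]]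

/-- The pencil of Example 6.1 is symmetric.
[cite: BlekhermanParriloThomas2012, Ch. 6 Example 6.1] -/
theorem isSymm_elliptopePencil (i : Fin 3) : (elliptopePencil i).IsSymm :=
  Matrix.IsSymm.ext fun j k => by
    fin_cases i <;> fin_cases j <;> fin_cases k <;> rfl

/-- `det [[1,x₁,x₂],[x₁,1,x₃],[x₂,x₃,1]] = 2x₁x₂x₃ − (x₁² + x₂² + x₃²) + 1`.
[cite: BlekhermanParriloThomas2012, Ch. 6 Example 6.1] -/
theorem monicPencilDet_elliptopePencil : monicPencilDet elliptopePencil = elliptopeCubic := by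
  rw [monicPencilDet, det_fin_three, elliptopeCubic]
  simp [elliptopePencil, Fin.sum_univ_three, Matrix.add_apply, Matrix.smul_apply]
  ring

/-- **Example 6.2(i).** The elliptope cubic is a real zero polynomial.
[cite: BlekhermanParriloThomas2012, Ch. 6 Example 6.2(i)] -/
theorem isRZPoly_elliptopeCubic : IsRZPoly elliptopeCubic := by
  rw [← monicPencilDet_elliptopePencil]
  exact isRZPoly_monicPencilDet _ isSymm_elliptopePencil

end Elliptope

/-! ## Example 6.2(ii) / §6.3.1: the TV screen is not RZ -/

section TVScreen

open MvPolynomial in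
/-- The TV-screen quartic `p(x) = 1 − x₁⁴ − x₂⁴` (variables indexed `0,1`).
[cite: BlekhermanParriloThomas2012, Ch. 6 Example 6.2(ii), §6.3.1] -/
def tvScreen : MvPolynomial (Fin 2) ℝ :=
  1 - X 0 ^ 4 - X 1 ^ 4

/-- Restriction of the TV-screen quartic to the `x₁`-axis: `p(t, 0) = 1 − t⁴`.
[cite: BlekhermanParriloThomas2012, Ch. 6 Example 6.2(ii)] -/
theorem linePoly_axis_tvScreen : linePoly tvScreen 0 ![1, 0] = 1 - X ^ 4 := by
  simp [linePoly, tvScreen]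

/-- `1 − t⁴` does not split over `ℝ`: it has the non-real complex root `i`.
[cite: BlekhermanParriloThomas2012, Ch. 6 Example 6.2(ii)] -/
theorem not_splits_one_sub_X_pow_four : ¬ ((1 : ℝ[X]) - X ^ 4).Splits := by
  intro h
  have h0 : ((1 : ℝ[X]) - X ^ 4) ≠ 0 := by
    intro h0
    have := congrArg (eval 0) h0
    simp at this
  have hI : (((1 : ℝ[X]) - X ^ 4).map (algebraMap ℝ ℂ)).IsRoot Complex.I := by
    have h4 : Complex.I ^ 4 = 1 := by
      rw [show (4 : ℕ) = 2 * 2 from rfl, pow_mul, Complex.I_sq]; norm_num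
    simp [IsRoot, h4]
  obtain ⟨r, hr⟩ := h.mem_range_of_isRoot h0 hI
  have := congrArg Complex.im hr
  simp at this

/-- Example 6.2(ii), as printed: for **every** direction `0 ≠ w ∈ ℝ²` the restriction
`t ↦ 1 − t⁴(w₁⁴ + w₂⁴)` of the TV-screen quartic has a non-real zero (namely `i·(w₁⁴+w₂⁴)^{-1/4}`),
so it does not split over `ℝ`. [cite: BlekhermanParriloThomas2012, Ch. 6 Example 6.2(ii)] -/
theorem not_splits_linePoly_tvScreen (w : Fin 2 → ℝ) (hw : w ≠ 0) :
    ¬ (linePoly tvScreen 0 w).Splits := by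
  set c : ℝ := w 0 ^ 4 + w 1 ^ 4 with hc_def
  have hc : 0 < c := by
    obtain ⟨i, hi⟩ := Function.ne_iff.mp hw
    have h4 : 0 < w i ^ 4 := Even.pow_pos (by decide) hi
    fin_cases i
    · exact add_pos_of_pos_of_nonneg h4 (Even.pow_nonneg (by decide) _)
    · exact add_pos_of_nonneg_of_pos (Even.pow_nonneg (by decide) _) h4
  set r : ℝ := Real.sqrt (Real.sqrt c⁻¹) with hr_def
  have hr4 : r ^ 4 = c⁻¹ := by
    have h1 : r ^ 2 = Real.sqrt c⁻¹ := Real.sq_sqrt (Real.sqrt_nonneg _)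
    calc r ^ 4 = (r ^ 2) ^ 2 := by ring
      _ = c⁻¹ := by rw [h1, Real.sq_sqrt (inv_nonneg.mpr hc.le)]
  have hr0 : 0 < r := Real.sqrt_pos.mpr (Real.sqrt_pos.mpr (inv_pos.mpr hc))
  have hkey : (r : ℂ) ^ 4 * ((w 0 : ℂ) ^ 4 + (w 1 : ℂ) ^ 4) = 1 := by
    have h : r ^ 4 * (w 0 ^ 4 + w 1 ^ 4) = 1 := by
      rw [hr4, ← hc_def, inv_mul_cancel₀ hc.ne']
    exact_mod_cast h
  have hI4 : Complex.I ^ 4 = 1 := by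
    rw [show (4 : ℕ) = 2 * 2 from rfl, pow_mul, Complex.I_sq]; norm_num
  intro h
  have hne : linePoly tvScreen 0 w ≠ 0 := by
    intro h0
    have := congrArg (Polynomial.eval 0) h0
    rw [eval_linePoly] at this
    simp [tvScreen] at this
  have hroot : ((linePoly tvScreen 0 w).map (algebraMap ℝ ℂ)).IsRoot (Complex.I * r) := by
    rw [IsRoot.def, Literature.AlgebraicGeometry.HyperbolicPolynomials.eval_map_linePoly]
    simp only [tvScreen, map_sub, map_one, map_pow, MvPolynomial.map_X, MvPolynomial.eval_X,
      Pi.zero_apply, Complex.ofReal_zero, zero_add]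
    linear_combination -((r : ℂ) ^ 4 * ((w 0 : ℂ) ^ 4 + (w 1 : ℂ) ^ 4)) * hI4 - hkey
  obtain ⟨a, ha⟩ := h.mem_range_of_isRoot hne hroot
  have him := congrArg Complex.im ha
  simp at him
  exact hr0.ne' him.symm

/-- **Example 6.2(ii).** The TV-screen quartic `1 − x₁⁴ − x₂⁴` is not a real zero polynomial.
[cite: BlekhermanParriloThomas2012, Ch. 6 Example 6.2(ii)] -/
theorem not_isRZPoly_tvScreen : ¬ IsRZPoly tvScreen := by
  intro h
  have h1 := h ![1, 0]
  rw [linePoly_axis_tvScreen] at h1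
  exact not_splits_one_sub_X_pow_four h1

/-- Consequently the TV-screen quartic is not the determinant of a monic symmetric linear pencil
of any size `n`. [cite: BlekhermanParriloThomas2012, Ch. 6 §6.2.3 (after Thm. 6.5), §6.3.1] -/
theorem tvScreen_ne_monicPencilDet {n : Type*} [Fintype n] [DecidableEq n]
    (A : Fin 2 → Matrix n n ℝ) (hA : ∀ i, (A i).IsSymm) : monicPencilDet A ≠ tvScreen := by
  intro h
  have := isRZPoly_monicPencilDet A hA
  rw [h] at this
  exact not_isRZPoly_tvScreen this

/-- Function form: there are no `d` and real symmetric `d × d` matrices `A₁, A₂` with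
`det (I + x₁A₁ + x₂A₂) = 1 − x₁⁴ − x₂⁴` for all real `x₁, x₂` — the TV screen `{1 − x₁⁴ − x₂⁴ ≥ 0}`
has no monic symmetric determinantal (LMI) representation with this defining polynomial.
[cite: BlekhermanParriloThomas2012, Ch. 6 §6.2.3 (after Thm. 6.5), §6.3.1] -/
theorem not_exists_monic_symmetric_detRep_tvScreen :
    ¬ ∃ (d : ℕ) (A : Fin 2 → Matrix (Fin d) (Fin d) ℝ), (∀ i, (A i).IsSymm) ∧
      ∀ x : Fin 2 → ℝ, det (1 + ∑ i, x i • A i) = 1 - x 0 ^ 4 - x 1 ^ 4 := by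
  rintro ⟨d, A, hA, hdet⟩
  refine tvScreen_ne_monicPencilDet A hA (MvPolynomial.funext fun x => ?_)
  rw [eval_monicPencilDet, hdet x]
  simp [tvScreen]

end TVScreen

/-! ## §6.3.1: the hyperboloid cubic is not RZ with respect to `u = (1,1,2)` -/

section Hyperboloid

open MvPolynomial in
/-- The hyperboloid cubic `x₁x₂x₃ − 1` (variables indexed `0,1,2`).
[cite: BlekhermanParriloThomas2012, Ch. 6 §6.3.1] -/
def hyperboloidCubic : MvPolynomial (Fin 3) ℝ :=
  X 0 * X 1 * X 2 - 1

/-- Restriction of `x₁x₂x₃ − 1` to the line `u + t w`, `u = (1,1,2)`, `w = (1,1,1)`: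
`(1+t)²(2+t) − 1 = t³ + 4t² + 5t + 1`. [cite: BlekhermanParriloThomas2012, Ch. 6 §6.3.1] -/
theorem linePoly_hyperboloidCubic :
    linePoly hyperboloidCubic ![1, 1, 2] ![1, 1, 1] = X ^ 3 + 4 * X ^ 2 + 5 * X + 1 := by
  simp only [linePoly, hyperboloidCubic, map_sub, map_mul, map_one, MvPolynomial.aeval_X]
  simp only [Matrix.cons_val_zero, Matrix.cons_val_one, Matrix.cons_val_two, Matrix.tail_cons,
    Matrix.head_cons, map_one, one_mul]
  have h2 : (C (2 : ℝ) : ℝ[X]) = 2 := map_ofNat C 2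
  rw [h2]
  ring

/-- The cubic `t³ + 4t² + 5t + 1` has discriminant `−23 < 0`, hence a pair of non-real roots:
it does not split over `ℝ`. [cite: BlekhermanParriloThomas2012, Ch. 6 §6.3.1] -/
theorem not_splits_hyperboloid_line : ¬ ((X : ℝ[X]) ^ 3 + 4 * X ^ 2 + 5 * X + 1).Splits := by
  intro h
  let P : Cubic ℝ := ⟨1, 4, 5, 1⟩
  have hP : P.toPoly = X ^ 3 + 4 * X ^ 2 + 5 * X + 1 := by
    simp only [Cubic.toPoly, P, map_one, one_mul, map_ofNat]
  have ha : P.a ≠ 0 := one_ne_zero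
  have hs : (P.toPoly.map (RingHom.id ℝ)).Splits := by rwa [Polynomial.map_id, hP]
  obtain ⟨x, y, z, h3⟩ := (Cubic.splits_iff_roots_eq_three ha).mp hs
  have hd := Cubic.discr_eq_prod_three_roots ha h3
  have hdisc : P.discr = -23 := by norm_num [Cubic.discr, P]
  rw [RingHom.id_apply, hdisc] at hd
  nlinarith [sq_nonneg ((RingHom.id ℝ) P.a * (RingHom.id ℝ) P.a * (x - y) * (x - z) * (y - z))]

/-- **§6.3.1.** The hyperboloid cubic `x₁x₂x₃ − 1` is not RZ with respect to the interior point
`u = (1,1,2)` of `{x ∈ ℝ³₊ : x₁x₂x₃ ≥ 1}`; so this convex set is not a spectrahedron with this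
defining polynomial, although it is a projected spectrahedron.
[cite: BlekhermanParriloThomas2012, Ch. 6 §6.3.1] -/
theorem not_isRZPolyAt_hyperboloidCubic : ¬ IsRZPolyAt ![1, 1, 2] hyperboloidCubic := by
  intro h
  have h1 := h ![1, 1, 1]
  rw [linePoly_hyperboloidCubic] at h1
  exact not_splits_hyperboloid_line h1

end Hyperboloid

end Literature.AlgebraicGeometry.DeterminantalHypersurfaces.MonicPencilRealZero
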